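import Summits.NavierStokesRegularity.NavierStokesRegularity.Theorems.TargetDepletionLadderDivCurlC1
import Literature.Analysis.FluidPDE.BiotSavartWeakLp
import HarnessLib

/-!
# Crux `Target` (stmt-NavierStokesRegularity-1217), line `depletion_ladder`, stub S1 (registered class):
# tools for the `L²` div–curl identity of BOUNDED fields — `K₃ ∗ : L² → L⁶`, the cut-off Hessian on
# the shell, local `L²` from local `L⁶`

`--supports stmt-NavierStokesRegularity-1217` (seat leafhand-ns-poloidalwindowdoor-3 g0, cell decomp-ns; step
(P2) of the registered-class programme for `stub_depletionBelowHalf`; the estimate/identity itself is in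
the companion file `TargetDepletionLadderBoundedDivCurl.lean`, which imports this one).

* `exists_lintegral_enorm_biotSavart_pow_six_le` — **`K₃ ∗ : L² → L⁶`**:
  `∫ ‖K₃ ∗ ω‖⁶ ≤ C (∫‖ω‖²)³`, from the pointwise domination `‖K₃ ∗ ω‖ ≤ (4π)⁻¹ I₁‖ω‖`
  (`enorm_biotSavart_le_rieszPotential`) and the tree's Hardy–Littlewood–Sobolev theorem
  (`lintegral_rieszPotential_rpow_le`, Stein 1970 Ch. V §1.2 Thm 1, `n = 3`, `α = 1`, `p = 2`, `q = 6`).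
* `fderiv_fderiv_cutoff_eq_zero_of_norm_lt`, `norm_fderiv_fderiv_cutoff_le_shell` — the Hessian of
  the radial cut-off `χ_R` (`Literature.Analysis.FluidPDE.cutoff`) vanishes on the open ball `|x| < R`,
  so the tree's bound `‖D²χ_R‖ ≤ C₂R⁻² 1_{|x| ≤ 2R}` improves to `C₂R⁻² 1_{R ≤ |x| ≤ 2R}`.
* `sq_le_add_pow_six_div`, `integral_indicator_mul_sq_norm_le` — the layer inequality
  `s² ≤ τ + s⁶/τ²` (`τ > 0`) and its integrated form `∫_S ‖w‖² ≤ τ|S| + τ⁻² ∫_S ‖w‖⁶`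
  (local `L²` from local `L⁶` without Hölder's inequality).
* `abs_integral_hessian_cutoff_le` — for `w` continuous with `‖w‖⁶ ∈ L¹` and every `a > 0`, `R > 0`:
  `|∫ D²χ_R(w, w)| ≤ 8 C₂ |B₁| a + C₂ a⁻² ∫_{R ≤ |x| ≤ 2R} ‖w‖⁶` (layer inequality with `τ = a/R`,
  `|B̄(0,2R)| = 8R³|B₁|`).
* `tendsto_integral_shell_pow_six` — the shell tails `∫_{R ≤ |x| ≤ 2R} ‖w‖⁶ → 0` (dominated
  convergence).

HONEST LABEL: helper tools (step P2 of an L/XL programme); closes no stub; no Navier–Stokes content;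
`Target`, S3 and NS regularity remain OPEN.

References: E. M. Stein, *Singular integrals and differentiability properties of functions* (1970),
Ch. V §1.2 Thm 1; A. J. Majda, A. L. Bertozzi (2002), §2.4.1 (4.30). [folklore]
-/


noncomputable section

-- the summit and its single sub-problem share the name (CONVENTIONS §1)
set_option linter.dupNamespace false

open MeasureTheory Set Function Filter Metric Real InnerProductSpace Topology
open scoped ENNReal NNReal RealInnerProductSpace
open Literature.Analysis.FluidPDE Literature.Analysis.SingularIntegrals

namespace Summit.NavierStokesRegularity.NavierStokesRegularity.Theorems.DepletionLadder.BoundedDivCurl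

/-! ### `K₃ ∗ : L²(ℝ³) → L⁶(ℝ³)` -/

/-- **The Biot–Savart law maps `L²` to `L⁶`.** There is `C < ∞` with
`∫ ‖(K₃ ∗ ω)(x)‖⁶ dx ≤ C (∫ ‖ω‖²)³` for every a.e.-strongly measurable `ω : ℝ³ → ℝ³`
(`‖K₃ ∗ ω‖ ≤ (4π)⁻¹ I₁‖ω‖` and the Hardy–Littlewood–Sobolev theorem with `n = 3`, `α = 1`, `p = 2`,
`q = np/(n − αp) = 6`). [cite: Stein1971, Ch. V §1.2 Theorem 1 (b)] -/
theorem exists_lintegral_enorm_biotSavart_pow_six_le :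
    ∃ C : ℝ≥0∞, C < ∞ ∧ ∀ ω : EuclideanSpace ℝ (Fin 3) → EuclideanSpace ℝ (Fin 3),
      AEStronglyMeasurable ω volume →
        ∫⁻ x, ‖biotSavart ω x‖ₑ ^ 6 ≤ C * (∫⁻ y, ‖ω y‖ₑ ^ 2) ^ 3 := by
  have h3 : (Module.finrank ℝ (EuclideanSpace ℝ (Fin 3)) : ℝ) = 3 := by
    rw [finrank_euclideanSpace_fin]; norm_num
  obtain ⟨C, hC, hHLS⟩ := lintegral_rieszPotential_rpow_le
    (μ := (volume : Measure (EuclideanSpace ℝ (Fin 3)))) (p := 2) (α := 1) one_lt_two one_pos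
    (by rw [h3]; norm_num)
  set c₀ : ℝ≥0∞ := ENNReal.ofReal (4 * Real.pi)⁻¹ with hc₀
  have hc₀t : c₀ ≠ ⊤ := ENNReal.ofReal_ne_top
  refine ⟨c₀ ^ 6 * C, ENNReal.mul_lt_top (ENNReal.pow_lt_top (lt_top_iff_ne_top.2 hc₀t)) hC,
    fun ω hω => ?_⟩
  set Φ : EuclideanSpace ℝ (Fin 3) → ℝ≥0∞ := fun y => (‖ω y‖ₑ : ℝ≥0∞) with hΦ
  have hΦm : AEMeasurable Φ volume := hω.enorm
  set I : EuclideanSpace ℝ (Fin 3) → ℝ≥0∞ := rieszPotential volume 1 Φ with hI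
  have h6 : ∀ z : ℝ≥0∞, z ^ (6 : ℝ) = z ^ 6 := fun z => by
    rw [show (6 : ℝ) = ((6 : ℕ) : ℝ) by norm_num, ENNReal.rpow_natCast]
  have h3' : ∀ z : ℝ≥0∞, z ^ (3 : ℝ) = z ^ 3 := fun z => by
    rw [show (3 : ℝ) = ((3 : ℕ) : ℝ) by norm_num, ENNReal.rpow_natCast]
  have hH := hHLS Φ hΦm
  rw [h3, show (3 : ℝ) * 2 / (3 - 1 * 2) = 6 by norm_num, show (3 : ℝ) / (3 - 1 * 2) = 3 by norm_num,
    h3'] at hH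
  have hpt : ∀ x, ‖biotSavart ω x‖ₑ ^ 6 ≤ c₀ ^ 6 * I x ^ (6 : ℝ) := by
    intro x
    have h := enorm_biotSavart_le_rieszPotential ω x
    calc ‖biotSavart ω x‖ₑ ^ 6 ≤ (c₀ * I x) ^ 6 := pow_le_pow_left' h 6
      _ = c₀ ^ 6 * I x ^ (6 : ℝ) := by rw [mul_pow, h6]
  have hsq : ∀ y, Φ y ^ (2 : ℝ) = ‖ω y‖ₑ ^ 2 := fun y => by rw [hΦ, ENNReal.rpow_two]
  simp_rw [hsq] at hH
  calc ∫⁻ x, ‖biotSavart ω x‖ₑ ^ 6 ≤ ∫⁻ x, c₀ ^ 6 * I x ^ (6 : ℝ) := lintegral_mono hpt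
    _ = c₀ ^ 6 * ∫⁻ x, I x ^ (6 : ℝ) := by
        rw [lintegral_const_mul' _ _ (ENNReal.pow_ne_top hc₀t)]
    _ ≤ c₀ ^ 6 * (C * (∫⁻ y, ‖ω y‖ₑ ^ 2) ^ 3) := mul_le_mul' le_rfl hH
    _ = c₀ ^ 6 * C * (∫⁻ y, ‖ω y‖ₑ ^ 2) ^ 3 := by rw [mul_assoc]

/-! ### The cut-off: its Hessian lives on the shell -/

/-- **The Hessian of `χ_R` vanishes on the open ball `|x| < R`** (`χ_R = 1` there). [folklore] -/
theorem fderiv_fderiv_cutoff_eq_zero_of_norm_lt {R : ℝ} (hR : 0 < R) {x : EuclideanSpace ℝ (Fin 3)}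
    (hx : ‖x‖ < R) :
    fderiv ℝ (fderiv ℝ (cutoff (E := EuclideanSpace ℝ (Fin 3)) R)) x = 0 := by
  have hopen : IsOpen {y : EuclideanSpace ℝ (Fin 3) | ‖y‖ < R} := isOpen_lt continuous_norm continuous_const
  have hD : ∀ y ∈ {y : EuclideanSpace ℝ (Fin 3) | ‖y‖ < R},
      fderiv ℝ (cutoff (E := EuclideanSpace ℝ (Fin 3)) R) y = 0 := by
    intro y hy
    have h1 : (cutoff (E := EuclideanSpace ℝ (Fin 3)) R) =ᶠ[𝓝 y] fun _ => (1 : ℝ) := by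
      filter_upwards [hopen.mem_nhds hy] with z hz
      exact cutoff_eq_one hR (le_of_lt hz)
    rw [h1.fderiv_eq]
    exact fderiv_const_apply (1 : ℝ)
  have h2 : fderiv ℝ (cutoff (E := EuclideanSpace ℝ (Fin 3)) R) =ᶠ[𝓝 x]
      fun _ => (0 : EuclideanSpace ℝ (Fin 3) →L[ℝ] ℝ) := by
    filter_upwards [hopen.mem_nhds hx] with z hz
    exact hD z hz
  rw [h2.fderiv_eq]
  exact fderiv_const_apply (0 : EuclideanSpace ℝ (Fin 3) →L[ℝ] ℝ)

/-- The shell `R ≤ |x| ≤ 2R`. [folklore] -/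
theorem measurableSet_shell (R : ℝ) :
    MeasurableSet (closedBall (0 : EuclideanSpace ℝ (Fin 3)) (2 * R) \ ball 0 R) :=
  measurableSet_closedBall.diff measurableSet_ball

/-- **Hessian bound on the shell**: with the tree's constant `C₂`
(`‖D²χ_R(x)‖ ≤ C₂R⁻² 1_{|x| ≤ 2R}`), in fact `‖D²χ_R(x)‖ ≤ C₂R⁻² 1_{R ≤ |x| ≤ 2R}`. [folklore] -/
theorem norm_fderiv_fderiv_cutoff_le_shell {C₂ : ℝ} (hC₂0 : 0 ≤ C₂)
    (hC₂ : ∀ R : ℝ, 0 < R → ∀ x : EuclideanSpace ℝ (Fin 3),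
      ‖fderiv ℝ (fderiv ℝ (cutoff R)) x‖ ≤
        C₂ / R ^ 2 * (closedBall (0 : EuclideanSpace ℝ (Fin 3)) (2 * R)).indicator (fun _ => (1 : ℝ)) x)
    {R : ℝ} (hR : 0 < R) (x : EuclideanSpace ℝ (Fin 3)) :
    ‖fderiv ℝ (fderiv ℝ (cutoff R)) x‖ ≤
      C₂ / R ^ 2 * (closedBall (0 : EuclideanSpace ℝ (Fin 3)) (2 * R) \ ball 0 R).indicator
        (fun _ => (1 : ℝ)) x := by
  by_cases hx : ‖x‖ < R
  · rw [fderiv_fderiv_cutoff_eq_zero_of_norm_lt hR hx]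
    refine (le_of_eq (@norm_zero ((EuclideanSpace ℝ (Fin 3)) →L[ℝ]
      (EuclideanSpace ℝ (Fin 3)) →L[ℝ] ℝ) _)).trans ?_
    exact mul_nonneg (div_nonneg hC₂0 (sq_nonneg _)) (indicator_nonneg (fun _ _ => zero_le_one) x)
  · refine (hC₂ R hR x).trans (mul_le_mul_of_nonneg_left ?_ (div_nonneg hC₂0 (sq_nonneg _)))
    by_cases h2 : x ∈ closedBall (0 : EuclideanSpace ℝ (Fin 3)) (2 * R)
    · have hmem : x ∈ closedBall (0 : EuclideanSpace ℝ (Fin 3)) (2 * R) \ ball 0 R :=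
        ⟨h2, by rw [mem_ball_zero_iff]; exact hx⟩
      rw [indicator_of_mem h2, indicator_of_mem hmem]
    · rw [indicator_of_notMem h2]
      exact indicator_nonneg (fun _ _ => zero_le_one) x

/-! ### From local `L⁶` to local `L²` without Hölder -/

/-- **Layer inequality**: `s² ≤ τ + s⁶/τ²` for `τ > 0` (if `s² ≤ τ` trivially, else
`s⁶/τ² ≥ s⁶/s⁴ = s²`). [folklore] -/
theorem sq_le_add_pow_six_div {s τ : ℝ} (hτ : 0 < τ) : s ^ 2 ≤ τ + s ^ 6 / τ ^ 2 := by
  have hτ2 : 0 < τ ^ 2 := by positivity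
  by_cases h : s ^ 2 ≤ τ
  · have : 0 ≤ s ^ 6 / τ ^ 2 := by positivity
    linarith
  · have hlt : τ < s ^ 2 := not_le.1 h
    have h1 : τ ^ 2 ≤ (s ^ 2) ^ 2 := pow_le_pow_left₀ hτ.le hlt.le 2
    have h2 : s ^ 2 * τ ^ 2 ≤ s ^ 6 := by
      calc s ^ 2 * τ ^ 2 ≤ s ^ 2 * (s ^ 2) ^ 2 := mul_le_mul_of_nonneg_left h1 (sq_nonneg _)
        _ = s ^ 6 := by ring
    have h3 : s ^ 2 ≤ s ^ 6 / τ ^ 2 := by rw [le_div_iff₀ hτ2]; exact h2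
    linarith

/-- **Local `L²` from local `L⁶`.** For `w` continuous with `‖w‖⁶ ∈ L¹`, a measurable set `S` of
finite measure and `τ > 0`: `∫ 1_S ‖w‖² ≤ τ |S| + τ⁻² ∫ 1_S ‖w‖⁶`. [folklore] -/
theorem integral_indicator_mul_sq_norm_le {w : EuclideanSpace ℝ (Fin 3) → EuclideanSpace ℝ (Fin 3)}
    (hwc : Continuous w) (hw6 : Integrable fun x => ‖w x‖ ^ 6) {S : Set (EuclideanSpace ℝ (Fin 3))}
    (hS : MeasurableSet S) (hSμ : volume S < ⊤) {τ : ℝ} (hτ : 0 < τ) :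
    Integrable (fun x => S.indicator (fun _ => (1 : ℝ)) x * ‖w x‖ ^ 2) ∧
    ∫ x, S.indicator (fun _ => (1 : ℝ)) x * ‖w x‖ ^ 2 ≤
      τ * (volume S).toReal + τ⁻¹ ^ 2 * ∫ x, S.indicator (fun _ => (1 : ℝ)) x * ‖w x‖ ^ 6 := by
  set χ : EuclideanSpace ℝ (Fin 3) → ℝ := S.indicator (fun _ => (1 : ℝ)) with hχ
  have hχ0 : ∀ x, 0 ≤ χ x := fun x => indicator_nonneg (fun _ _ => zero_le_one) x
  have hχ1 : ∀ x, χ x ≤ 1 := fun x => indicator_apply_le' (fun _ => le_rfl) (fun _ => zero_le_one)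
  have hχm : Measurable χ := measurable_const.indicator hS
  have hχi : Integrable χ := by
    rw [hχ, integrable_indicator_iff hS]
    exact integrableOn_const hSμ.ne
  have hvol : ∫ x, χ x = (volume S).toReal := by
    rw [hχ, integral_indicator_const _ hS, smul_eq_mul, mul_one, measureReal_def]
  -- integrability of the two weighted integrands (dominated by constants times integrable ones)
  have hi6 : Integrable fun x => χ x * ‖w x‖ ^ 6 := by
    refine hw6.mono' (hχm.aestronglyMeasurable.mul (hwc.norm.pow 6).aestronglyMeasurable)
      (Eventually.of_forall fun x => ?_)
    rw [Real.norm_of_nonneg (mul_nonneg (hχ0 x) (by positivity))]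
    exact mul_le_of_le_one_left (by positivity) (hχ1 x)
  have hmaj : Integrable fun x => τ * χ x + τ⁻¹ ^ 2 * (χ x * ‖w x‖ ^ 6) :=
    (hχi.const_mul τ).add (hi6.const_mul _)
  have hpt : ∀ x, χ x * ‖w x‖ ^ 2 ≤ τ * χ x + τ⁻¹ ^ 2 * (χ x * ‖w x‖ ^ 6) := by
    intro x
    have h := sq_le_add_pow_six_div (s := ‖w x‖) hτ
    have hτ2 : τ⁻¹ ^ 2 = (τ ^ 2)⁻¹ := by rw [inv_pow]
    calc χ x * ‖w x‖ ^ 2 ≤ χ x * (τ + ‖w x‖ ^ 6 / τ ^ 2) := mul_le_mul_of_nonneg_left h (hχ0 x)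
      _ = τ * χ x + τ⁻¹ ^ 2 * (χ x * ‖w x‖ ^ 6) := by rw [hτ2]; ring
  have hi2 : Integrable fun x => χ x * ‖w x‖ ^ 2 := by
    refine hmaj.mono' (hχm.aestronglyMeasurable.mul (hwc.norm.pow 2).aestronglyMeasurable)
      (Eventually.of_forall fun x => ?_)
    rw [Real.norm_of_nonneg (mul_nonneg (hχ0 x) (by positivity))]
    exact hpt x
  refine ⟨hi2, ?_⟩
  calc ∫ x, χ x * ‖w x‖ ^ 2 ≤ ∫ x, (τ * χ x + τ⁻¹ ^ 2 * (χ x * ‖w x‖ ^ 6)) := integral_mono hi2 hmaj hpt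
    _ = τ * (volume S).toReal + τ⁻¹ ^ 2 * ∫ x, χ x * ‖w x‖ ^ 6 := by
        rw [integral_add (hχi.const_mul τ) (hi6.const_mul _), integral_const_mul, integral_const_mul,
          hvol]

/-! ### The error of the cut-off identity -/

/-- **The Hessian error term.** For `w` continuous with `‖w‖⁶ ∈ L¹`, the tree's cut-off constant `C₂`,
`R > 0` and every `a > 0`:
`|∫ D²χ_R(w, w)| ≤ 8 C₂ |B₁| a + C₂ a⁻² ∫ 1_{R ≤ |x| ≤ 2R} ‖w‖⁶` (`|B₁| = |B(0,1)|`). Proof: the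
integrand is bounded by `C₂R⁻² 1_{shell} ‖w‖²`, and the layer inequality with `τ = a/R` turns
`R⁻² ∫_{shell} ‖w‖²` into `R⁻²(a R⁻¹ · 8R³|B₁| + R²a⁻² ∫_{shell}‖w‖⁶)`. [folklore] -/
theorem abs_integral_hessian_cutoff_le {w : EuclideanSpace ℝ (Fin 3) → EuclideanSpace ℝ (Fin 3)}
    (hwc : Continuous w) (hw6 : Integrable fun x => ‖w x‖ ^ 6) {C₂ : ℝ} (hC₂0 : 0 ≤ C₂)
    (hC₂ : ∀ R : ℝ, 0 < R → ∀ x : EuclideanSpace ℝ (Fin 3),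
      ‖fderiv ℝ (fderiv ℝ (cutoff R)) x‖ ≤
        C₂ / R ^ 2 * (closedBall (0 : EuclideanSpace ℝ (Fin 3)) (2 * R)).indicator (fun _ => (1 : ℝ)) x)
    {R : ℝ} (hR : 0 < R) {a : ℝ} (ha : 0 < a) :
    |∫ x, fderiv ℝ (fderiv ℝ (cutoff R)) x (w x) (w x)| ≤
      8 * C₂ * (volume (ball (0 : EuclideanSpace ℝ (Fin 3)) 1)).toReal * a +
        C₂ * a⁻¹ ^ 2 * ∫ x, (closedBall (0 : EuclideanSpace ℝ (Fin 3)) (2 * R) \ ball 0 R).indicator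
          (fun _ => (1 : ℝ)) x * ‖w x‖ ^ 6 := by
  set S : Set (EuclideanSpace ℝ (Fin 3)) := closedBall (0 : EuclideanSpace ℝ (Fin 3)) (2 * R) \ ball 0 R
    with hSdef
  set V₁ : ℝ := (volume (ball (0 : EuclideanSpace ℝ (Fin 3)) 1)).toReal with hV₁
  have hS : MeasurableSet S := measurableSet_shell R
  have hSsub : S ⊆ closedBall (0 : EuclideanSpace ℝ (Fin 3)) (2 * R) := fun _ hx => hx.1
  have hSμ : volume S < ⊤ := lt_of_le_of_lt (measure_mono hSsub) measure_closedBall_lt_top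
  have hvolS : (volume S).toReal ≤ (2 * R) ^ 3 * V₁ := by
    have h1 : (volume S).toReal ≤ (volume (closedBall (0 : EuclideanSpace ℝ (Fin 3)) (2 * R))).toReal :=
      ENNReal.toReal_mono measure_closedBall_lt_top.ne (measure_mono hSsub)
    have h2 : (volume (closedBall (0 : EuclideanSpace ℝ (Fin 3)) (2 * R))).toReal = (2 * R) ^ 3 * V₁ := by
      rw [Measure.addHaar_closedBall _ _ (by positivity : (0 : ℝ) ≤ 2 * R), ENNReal.toReal_mul,
        finrank_euclideanSpace_fin, ENNReal.toReal_ofReal (by positivity)]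
    rw [h2] at h1
    exact h1
  set χ : EuclideanSpace ℝ (Fin 3) → ℝ := S.indicator (fun _ => (1 : ℝ)) with hχ
  have hχ0 : ∀ x, 0 ≤ χ x := fun x => indicator_nonneg (fun _ _ => zero_le_one) x
  -- layer inequality with `τ = a / R`
  have hτ : 0 < a / R := div_pos ha hR
  obtain ⟨hi2, hlayer⟩ := integral_indicator_mul_sq_norm_le hwc hw6 hS hSμ hτ
  -- pointwise bound of the Hessian integrand
  have hpt : ∀ x, ‖fderiv ℝ (fderiv ℝ (cutoff R)) x (w x) (w x)‖ ≤ C₂ / R ^ 2 * (χ x * ‖w x‖ ^ 2) := by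
    intro x
    calc ‖fderiv ℝ (fderiv ℝ (cutoff R)) x (w x) (w x)‖
        ≤ ‖fderiv ℝ (fderiv ℝ (cutoff R)) x (w x)‖ * ‖w x‖ := ContinuousLinearMap.le_opNorm _ _
      _ ≤ ‖fderiv ℝ (fderiv ℝ (cutoff R)) x‖ * ‖w x‖ * ‖w x‖ :=
          mul_le_mul_of_nonneg_right (ContinuousLinearMap.le_opNorm _ _) (norm_nonneg _)
      _ ≤ (C₂ / R ^ 2 * χ x) * ‖w x‖ * ‖w x‖ := by
          gcongr
          exact norm_fderiv_fderiv_cutoff_le_shell hC₂0 hC₂ hR x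
      _ = C₂ / R ^ 2 * (χ x * ‖w x‖ ^ 2) := by ring
  have hmaj : Integrable fun x => C₂ / R ^ 2 * (χ x * ‖w x‖ ^ 2) := hi2.const_mul _
  have h1 : |∫ x, fderiv ℝ (fderiv ℝ (cutoff R)) x (w x) (w x)| ≤ C₂ / R ^ 2 * ∫ x, χ x * ‖w x‖ ^ 2 := by
    have h := norm_integral_le_of_norm_le hmaj (Eventually.of_forall hpt)
    rw [Real.norm_eq_abs, integral_const_mul] at h
    exact h
  have hc0 : 0 ≤ C₂ / R ^ 2 := div_nonneg hC₂0 (sq_nonneg _)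
  have hV₁0 : 0 ≤ V₁ := ENNReal.toReal_nonneg
  have hI6 : 0 ≤ ∫ x, χ x * ‖w x‖ ^ 6 := integral_nonneg fun x => mul_nonneg (hχ0 x) (by positivity)
  calc |∫ x, fderiv ℝ (fderiv ℝ (cutoff R)) x (w x) (w x)|
      ≤ C₂ / R ^ 2 * ∫ x, χ x * ‖w x‖ ^ 2 := h1
    _ ≤ C₂ / R ^ 2 * ((a / R) * (volume S).toReal + (a / R)⁻¹ ^ 2 * ∫ x, χ x * ‖w x‖ ^ 6) :=
        mul_le_mul_of_nonneg_left hlayer hc0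
    _ ≤ C₂ / R ^ 2 * ((a / R) * ((2 * R) ^ 3 * V₁) + (a / R)⁻¹ ^ 2 * ∫ x, χ x * ‖w x‖ ^ 6) := by
        gcongr
    _ = 8 * C₂ * V₁ * a + C₂ * a⁻¹ ^ 2 * ∫ x, χ x * ‖w x‖ ^ 6 := by
        have hR0 : R ≠ 0 := hR.ne'
        have ha0 : a ≠ 0 := ha.ne'
        field_simp
        ring

/-- **The shell tails of `‖w‖⁶` vanish**: `∫ 1_{R ≤ |x| ≤ 2R} ‖w‖⁶ → 0` as `R → ∞` for `‖w‖⁶ ∈ L¹`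
(dominated convergence; at every `x` the integrand is `0` once `R > |x|`). [folklore] -/
theorem tendsto_integral_shell_pow_six {w : EuclideanSpace ℝ (Fin 3) → EuclideanSpace ℝ (Fin 3)}
    (hwc : Continuous w) (hw6 : Integrable fun x => ‖w x‖ ^ 6) :
    Tendsto (fun R : ℝ => ∫ x, (closedBall (0 : EuclideanSpace ℝ (Fin 3)) (2 * R) \ ball 0 R).indicator
      (fun _ => (1 : ℝ)) x * ‖w x‖ ^ 6) atTop (𝓝 0) := by
  have h0 : (0 : ℝ) = ∫ _ : EuclideanSpace ℝ (Fin 3), (0 : ℝ) := by rw [integral_zero]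
  rw [h0]
  refine tendsto_integral_filter_of_dominated_convergence (fun x => ‖w x‖ ^ 6) ?_ ?_ hw6 ?_
  · refine Eventually.of_forall fun R => ?_
    exact ((measurable_const.indicator (measurableSet_shell R)).aestronglyMeasurable).mul
      (hwc.norm.pow 6).aestronglyMeasurable
  · refine Eventually.of_forall fun R => Eventually.of_forall fun x => ?_
    have hχ0 : 0 ≤ (closedBall (0 : EuclideanSpace ℝ (Fin 3)) (2 * R) \ ball 0 R).indicator
        (fun _ => (1 : ℝ)) x := indicator_nonneg (fun _ _ => zero_le_one) x
    have hχ1 : (closedBall (0 : EuclideanSpace ℝ (Fin 3)) (2 * R) \ ball 0 R).indicator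
        (fun _ => (1 : ℝ)) x ≤ 1 := indicator_apply_le' (fun _ => le_rfl) (fun _ => zero_le_one)
    rw [Real.norm_of_nonneg (mul_nonneg hχ0 (by positivity))]
    exact mul_le_of_le_one_left (by positivity) hχ1
  · refine Eventually.of_forall fun x => ?_
    refine tendsto_const_nhds.congr' ?_
    filter_upwards [eventually_gt_atTop ‖x‖] with R hR
    have hx : x ∉ closedBall (0 : EuclideanSpace ℝ (Fin 3)) (2 * R) \ ball 0 R := fun h =>
      h.2 (mem_ball_zero_iff.2 hR)
    rw [indicator_of_notMem hx, zero_mul]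

end Summit.NavierStokesRegularity.NavierStokesRegularity.Theorems.DepletionLadder.BoundedDivCurl

end
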